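import Summits.RiemannHypothesis.RiemannHypothesis.Theses.GroundBarta
import Summits.RiemannHypothesis.RiemannHypothesis.Theorems.GroundBartaPolarPerronFrobeniusConeBottom
import Summits.RiemannHypothesis.RiemannHypothesis.Theorems.GroundBartaPolarPerronFrobeniusKernelCriterion
import Summits.RiemannHypothesis.RiemannHypothesis.Theorems.GroundBartaPolarPerronFrobeniusEvenKernel
import HarnessLib

/-!
# RiemannHypothesis / GroundBarta — crux `PolarPerronFrobenius` (stmt-RiemannHypothesis-18390):
# Perron–Frobenius on every window `0 < a ≤ 11/40` (the even kernel threshold, certified further out)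

Helper file (`--supports stmt-RiemannHypothesis-18390`), RH-free, Mathlib + landed tree files only, no
definitions, no named facts.  The even-sector sign-improvement mechanism (`Theorems/…EvenKernel.lean`,
`…KernelCriterion.lean`, `…EvenSmallWindows.lean`) needs the single scalar inequality `1 + cosh a ≤ w(a)`
(`w = weilArchDensity = e^{a/2}/(2 sinh a)`), whose true threshold is `a = 0.27822…`; it was certified at
`a = 1/4`.  This file certifies it at `a = 11/40 = 0.275` (fourth-order Taylor bounds for `e^{±11/40}`,
`Real.exp_bound`; margin `2.038 < 2.056`) and runs the landed numerics-free chain: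

* `et_one_add_cosh_le_weilArchDensity` (`0 < a ≤ 11/40 ⇒ 1 + cosh a ≤ w(a)`), `et_evenKernel`
  (the even kernel hypothesis `2cosh(s/2) + 2cosh(t/2) ≤ w(s) + w(t)` on `s + t ≤ 2a`);
* `et_evenConeDense`, `et_coneDense` (`swu_evenConeDense_of_kernel_even` + S2 with the RH-free parity order
  up to `63/100`), `et_exists_nonneg_isWeilGroundState` — **`GSP a` for every `0 < a ≤ 11/40`** (was `1/4`);
  `et_coneBottom_eq` (`ε₊ = ε` there);
* `exists_firstBadHeight_ge_of_not_riemannHypothesis` (generic: GSP on `(0, b]` ⇒ the first bad height off RH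
  is `≥ b`) and `exists_firstBadHeight_ge_11_40_of_not_riemannHypothesis`.

Prover B, speedrun unit `sr-gb-rung-b` (seat 3).
-/

set_option linter.dupNamespace false

noncomputable section

open MeasureTheory Complex Filter Set
open scoped Real Topology

namespace Summit.RiemannHypothesis.RiemannHypothesis.Theorems.PolarPerronFrobenius

open Literature.NumberTheory.LFunctions
open Summit.RiemannHypothesis.RiemannHypothesis.Theses.GroundBarta

/-! ### Numerics at `a = 11/40` -/

/-- `e^{11/40} ≤ 1.3166` (fourth-order Taylor bound). [folklore] -/
theorem et_exp_le : Real.exp (11 / 40) ≤ 13166 / 10000 := by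
  have h := Real.exp_bound' (show (0 : ℝ) ≤ 11 / 40 by norm_num) (show (11 / 40 : ℝ) ≤ 1 by norm_num)
    (show 0 < 4 by norm_num)
  norm_num [Finset.sum_range_succ, Nat.factorial] at h
  linarith

/-- `0.7590 ≤ e^{-11/40} ≤ 0.7597` (fourth-order Taylor bound). [folklore] -/
theorem et_exp_neg_bounds :
    (7590 / 10000 : ℝ) ≤ Real.exp (-(11 / 40)) ∧ Real.exp (-(11 / 40)) ≤ 7597 / 10000 := by
  have h := Real.exp_bound (x := -(11 / 40 : ℝ)) (by norm_num [abs_le]) (n := 4) (by norm_num)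
  have h' := abs_le.1 h
  norm_num [Finset.sum_range_succ, Nat.factorial] at h'
  constructor <;> linarith [h'.1, h'.2]

/-- `1 + cosh(11/40) ≤ 2.0382`. [folklore] -/
theorem et_one_add_cosh_le : 1 + Real.cosh (11 / 40) ≤ 20382 / 10000 := by
  rw [Real.cosh_eq]
  linarith [et_exp_le, et_exp_neg_bounds.2]

/-- `2.05 ≤ w(11/40)` (`e^{11/80} ≥ 1 + 11/80 + (11/80)²/2`, `sinh(11/40) ≤ (1.3166 − 0.7590)/2`). [folklore] -/
theorem et_weilArchDensity_ge : (205 / 100 : ℝ) ≤ weilArchDensity (11 / 40) := by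
  have hs : Real.sinh (11 / 40) ≤ 2788 / 10000 := by
    rw [Real.sinh_eq]
    linarith [et_exp_le, et_exp_neg_bounds.1]
  have hs0 : 0 < Real.sinh (11 / 40) := Real.sinh_pos_iff.2 (by norm_num)
  have he : (1 : ℝ) + 11 / 80 + (11 / 80) ^ 2 / 2 ≤ Real.exp (11 / 40 / 2) := by
    have := Real.quadratic_le_exp_of_nonneg (show (0 : ℝ) ≤ 11 / 40 / 2 by norm_num)
    norm_num at this ⊢
    exact this
  unfold weilArchDensity
  rw [le_div_iff₀ (by positivity)]
  nlinarith

/-! ### The threshold inequality and the even kernel hypothesis on `(0, 11/40]` -/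

/-- **`1 + cosh a ≤ w(a)` for `0 < a ≤ 11/40`** (`w` non-increasing, `cosh` non-decreasing on `[0, ∞)`;
numerics at `11/40`; true threshold `0.27822…`). [folklore] -/
theorem et_one_add_cosh_le_weilArchDensity {a : ℝ} (ha : 0 < a) (ha' : a ≤ 11 / 40) :
    1 + Real.cosh a ≤ weilArchDensity a := by
  have h1 : Real.cosh a ≤ Real.cosh (11 / 40) := by
    rw [Real.cosh_le_cosh, abs_of_pos ha, abs_of_pos (by norm_num : (0 : ℝ) < 11 / 40)]
    exact ha'
  have h2 : weilArchDensity (11 / 40) ≤ weilArchDensity a :=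
    weilArchDensity_antitoneOn (mem_Ioi.2 ha) (mem_Ioi.2 (by norm_num)) ha'
  linarith [et_one_add_cosh_le, et_weilArchDensity_ge]

/-- **The even kernel hypothesis on `(0, 11/40]`**: `2cosh(s/2) + 2cosh(t/2) ≤ w(s) + w(t)` whenever
`0 < s`, `0 < t`, `s + t ≤ 2a` (`cosh(s/2)+cosh(t/2) ≤ 1 + cosh a ≤ w(a) ≤ w((s+t)/2)`, midpoint convexity of
`w`). [folklore] -/
theorem et_evenKernel {a : ℝ} (ha : 0 < a) (ha' : a ≤ 11 / 40) :
    ∀ s t : ℝ, 0 < s → 0 < t → s + t ≤ 2 * a →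
      2 * Real.cosh (s / 2) + 2 * Real.cosh (t / 2) ≤ weilArchDensity s + weilArchDensity t := by
  intro s t hs ht hst
  have hcosh := swe_cosh_half_add_le hs.le ht.le hst
  have hmid := swe_weilArchDensity_midpoint hs ht
  have hm0 : 0 < (s + t) / 2 := by linarith
  have hanti : weilArchDensity a ≤ weilArchDensity ((s + t) / 2) :=
    weilArchDensity_antitoneOn (mem_Ioi.2 hm0) (mem_Ioi.2 ha) (by linarith)
  have hthr := et_one_add_cosh_le_weilArchDensity ha ha'
  linarith

/-! ### Perron–Frobenius on `(0, 11/40]` -/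

/-- **Even cone density (the S1 matrix's conclusion) at every window `0 < a ≤ 11/40`.** [folklore] -/
theorem et_evenConeDense {a : ℝ} (ha : 0 < a) (ha' : a ≤ 11 / 40) :
    ∀ h : ℝ → ℂ, IsWeilTest h → tsupport h ⊆ Set.Icc (-a) a → (∀ t, h (-t) = h t) →
      ∫ t, ‖h t‖ ^ 2 = (1 : ℝ) → ∀ δ : ℝ, 0 < δ →
        ∃ w : ℝ → ℂ, IsWeilTest w ∧ tsupport w ⊆ Set.Icc (-a) a ∧ (∀ t, w (-t) = w t) ∧
          (∀ t, (w t).im = 0 ∧ 0 ≤ (w t).re) ∧ ∫ t, ‖w t‖ ^ 2 = (1 : ℝ) ∧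
          (weilQuadratic w).re ≤ (weilQuadratic h).re + δ :=
  swu_evenConeDense_of_kernel_even ha (et_evenKernel ha ha')

/-- **Cone density at every window `0 < a ≤ 11/40`** (S2 with the RH-free parity order up to `63/100`). [folklore] -/
theorem et_coneDense {a : ℝ} (ha : 0 < a) (ha' : a ≤ 11 / 40) :
    ∀ h : ℝ → ℂ, IsWeilTest h → tsupport h ⊆ Set.Icc (-a) a → ∫ t, ‖h t‖ ^ 2 = (1 : ℝ) →
      ∀ δ : ℝ, 0 < δ → ∃ w : ℝ → ℂ, IsWeilTest w ∧ tsupport w ⊆ Set.Icc (-a) a ∧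
        (∀ t, (w t).im = 0 ∧ 0 ≤ (w t).re) ∧ ∫ t, ‖w t‖ ^ 2 = (1 : ℝ) ∧
        (weilQuadratic w).re ≤ (weilQuadratic h).re + δ :=
  stub_coneDense_of_even a ha
    (Summit.RiemannHypothesis.RiemannHypothesis.Theorems.WeilParity.evenSectorWins_upTo_63 a ha
      (by linarith))
    (et_evenConeDense ha ha')

/-- **Perron–Frobenius on every window `0 < a ≤ 11/40`**: the full windowed Weil form has a ground state that
is real and `≥ 0` a.e. on `(-a, a)`. [folklore] -/
theorem et_exists_nonneg_isWeilGroundState {a : ℝ} (ha : 0 < a) (ha' : a ≤ 11 / 40) :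
    ∃ u : ℝ → ℂ, IsWeilGroundState a u ∧ ∀ᵐ t : ℝ, t ∈ Ioo (-a) a → (u t).im = 0 ∧ 0 ≤ (u t).re :=
  exists_oneSigned_of_coneDense ha (et_coneDense ha ha')

/-- An EVEN, real-valued, everywhere `≥ 0` ground state at every window `0 < a ≤ 11/40`. [folklore] -/
theorem et_exists_even_real_nonneg_isWeilGroundState {a : ℝ} (ha : 0 < a) (ha' : a ≤ 11 / 40) :
    ∃ u : ℝ → ℂ, IsWeilGroundState a u ∧ (∀ t, u (-t) = u t) ∧ (∀ t, (u t).im = 0) ∧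
      ∀ t, 0 ≤ (u t).re := by
  obtain ⟨u, hu, hsign⟩ := et_exists_nonneg_isWeilGroundState ha ha'
  exact exists_even_real_nonneg_of_oneSigned hu hsign

/-- `ε₊(a) = ε(a)` (cone bottom = bottom) on `(0, 11/40]`. [folklore] -/
theorem et_coneBottom_eq {a : ℝ} (ha : 0 < a) (ha' : a ≤ 11 / 40) :
    sInf (weilWindowSphereValues (fun g : ℝ → ℂ ↦ ∀ t, (g t).im = 0 ∧ 0 ≤ (g t).re) a) =
      weilGroundEnergy a :=
  (oneSigned_iff_coneBottom_eq ha).1 (et_exists_nonneg_isWeilGroundState ha ha')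

/-! ### First bad height, generic lower bound -/

/-- **Generic first bad height.**  If every window in `(0, b]` (`b > 0`) carries a one-signed ground state and RH
fails, there is a first bad height `a₁ ≥ b`: every window `0 < a ≤ a₁` is good and bad windows accumulate at
`a₁` from the right. [folklore] -/
theorem exists_firstBadHeight_ge_of_not_riemannHypothesis {b : ℝ} (hb : 0 < b)
    (hgood : ∀ a : ℝ, 0 < a → a ≤ b → ∃ u : ℝ → ℂ, IsWeilGroundState a u ∧
      ∀ᵐ t : ℝ, t ∈ Ioo (-a) a → (u t).im = 0 ∧ 0 ≤ (u t).re)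
    (hRH : ¬ RiemannHypothesis) :
    ∃ a₁ : ℝ, b ≤ a₁ ∧
      (∀ a : ℝ, 0 < a → a ≤ a₁ → ∃ u : ℝ → ℂ, IsWeilGroundState a u ∧
        ∀ᵐ t : ℝ, t ∈ Ioo (-a) a → (u t).im = 0 ∧ 0 ≤ (u t).re) ∧
      ∀ ε : ℝ, 0 < ε → ∃ a : ℝ, a₁ < a ∧ a < a₁ + ε ∧ ∀ u : ℝ → ℂ, IsWeilGroundState a u →
        ¬ (∀ᵐ t : ℝ, t ∈ Ioo (-a) a → (u t).im = 0 ∧ 0 ≤ (u t).re) := by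
  -- adapted from `exists_firstBadHeight_of_not_riemannHypothesis` (b = 1/4)
  set Bad : Set ℝ := {a : ℝ | 0 < a ∧ ∀ u : ℝ → ℂ, IsWeilGroundState a u →
    ¬ (∀ᵐ t : ℝ, t ∈ Ioo (-a) a → (u t).im = 0 ∧ 0 ≤ (u t).re)} with hBad
  obtain ⟨A, hA⟩ := eventually_atTop.1 (eventually_not_oneSigned_of_not_riemannHypothesis hRH)
  have hne : Bad.Nonempty := ⟨max A 1, lt_of_lt_of_le one_pos (le_max_right _ _), hA _ (le_max_left _ _)⟩
  have hlb : ∀ c ∈ Bad, b < c := by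
    intro c hc
    by_contra hle
    obtain ⟨u, hu, hsign⟩ := hgood c hc.1 (not_lt.1 hle)
    exact hc.2 u hu hsign
  have hbdd : BddBelow Bad := ⟨b, fun c hc ↦ (hlb c hc).le⟩
  set a₁ : ℝ := sInf Bad with ha₁
  have ha₁b : b ≤ a₁ := le_csInf hne fun c hc ↦ (hlb c hc).le
  have ha₁pos : 0 < a₁ := lt_of_lt_of_le hb ha₁b
  have hbelow : ∀ a : ℝ, 0 < a → a < a₁ → ∃ u : ℝ → ℂ, IsWeilGroundState a u ∧
      ∀ᵐ t : ℝ, t ∈ Ioo (-a) a → (u t).im = 0 ∧ 0 ≤ (u t).re := by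
    intro a ha hlt
    by_contra hno
    have hmem : a ∈ Bad := ⟨ha, fun u hu hsign ↦ hno ⟨u, hu, hsign⟩⟩
    exact (not_le.2 hlt) (csInf_le hbdd hmem)
  have ha₁good : ∃ u : ℝ → ℂ, IsWeilGroundState a₁ u ∧
      ∀ᵐ t : ℝ, t ∈ Ioo (-a₁) a₁ → (u t).im = 0 ∧ 0 ≤ (u t).re := by
    set c : ℕ → ℝ := fun n ↦ a₁ * (1 - 1 / ((n : ℝ) + 2)) with hcdef
    have hc : Tendsto c atTop (𝓝 a₁) := by
      have h1 : Tendsto (fun n : ℕ ↦ 1 / ((n : ℝ) + 2)) atTop (𝓝 0) := by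
        have := tendsto_one_div_add_atTop_nhds_zero_nat (𝕜 := ℝ).comp (tendsto_add_atTop_nat 1)
        refine this.congr fun n ↦ ?_
        simp only [Function.comp_apply, Nat.cast_add, Nat.cast_one]
        ring
      have h2 := (tendsto_const_nhds (x := (1 : ℝ))).sub h1
      rw [sub_zero] at h2
      simpa [hcdef] using h2.const_mul a₁
    refine gsp_seqClosed a₁ c ha₁pos hc fun n ↦ hbelow (c n) ?_ ?_
    · have : (0 : ℝ) < 1 - 1 / ((n : ℝ) + 2) := by
        rw [sub_pos, div_lt_one (by positivity)]; linarith [n.cast_nonneg (α := ℝ)]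
      exact mul_pos ha₁pos this
    · have : 1 - 1 / ((n : ℝ) + 2) < 1 := by
        have : (0 : ℝ) < 1 / ((n : ℝ) + 2) := by positivity
        linarith
      calc c n = a₁ * (1 - 1 / ((n : ℝ) + 2)) := rfl
        _ < a₁ * 1 := mul_lt_mul_of_pos_left this ha₁pos
        _ = a₁ := mul_one _
  refine ⟨a₁, ha₁b, fun a ha hle ↦ ?_, fun ε hε ↦ ?_⟩
  · rcases hle.lt_or_eq with hlt | heq
    · exact hbelow a ha hlt
    · rw [heq]; exact ha₁good
  · obtain ⟨c, hcmem, hclt⟩ := exists_lt_of_csInf_lt hne (show sInf Bad < a₁ + ε by linarith)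
    have hca : a₁ ≤ c := csInf_le hbdd hcmem
    have hne' : c ≠ a₁ := by
      rintro rfl
      obtain ⟨u, hu, hsign⟩ := ha₁good
      exact hcmem.2 u hu hsign
    exact ⟨c, lt_of_le_of_ne hca (Ne.symm hne'), hclt, hcmem.2⟩

/-- **If RH fails, the first bad height is `≥ 11/40`.** [folklore] -/
theorem exists_firstBadHeight_ge_11_40_of_not_riemannHypothesis (hRH : ¬ RiemannHypothesis) :
    ∃ a₁ : ℝ, 11 / 40 ≤ a₁ ∧
      (∀ a : ℝ, 0 < a → a ≤ a₁ → ∃ u : ℝ → ℂ, IsWeilGroundState a u ∧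
        ∀ᵐ t : ℝ, t ∈ Ioo (-a) a → (u t).im = 0 ∧ 0 ≤ (u t).re) ∧
      ∀ ε : ℝ, 0 < ε → ∃ a : ℝ, a₁ < a ∧ a < a₁ + ε ∧ ∀ u : ℝ → ℂ, IsWeilGroundState a u →
        ¬ (∀ᵐ t : ℝ, t ∈ Ioo (-a) a → (u t).im = 0 ∧ 0 ≤ (u t).re) :=
  exists_firstBadHeight_ge_of_not_riemannHypothesis (by norm_num)
    (fun _ ha ha' ↦ et_exists_nonneg_isWeilGroundState ha ha') hRH

end Summit.RiemannHypothesis.RiemannHypothesis.Theorems.PolarPerronFrobenius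

end
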